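import Mathlib
import HarnessLib

/-!
# VIRIAL HORN, W-ii (4/6): PRIMITIVE COEFFICIENT ARRAYS — the max-weight argument (pure combinatorics, no polynomials)

Route `UnthreadedRigidityDoor`, item `UnthreadedRigidity` (W2, stmt-NavierStokesRegularity-27585) — LINE g11-1 «VIRIAL HORN»,
DIRECTOR-NS KEY-NS #210 (W-ii): the ALL-DEGREE BRACKET INJECTIVITY `bracketInjective_all` (= the hypothesis `hinj` of p712484
`windowWedgeAnalyticL_of_bracketInjective`, every `l ≥ 1`), by a kernel road that needs neither the `SO(3)`-isotypic decomposition of `Λ²𝓗_l`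
nor a closed form of Legendre coefficients (ns-crc-p2 g10; `--supports stmt-NavierStokesRegularity-27585`, helper; 0 kit).

CONTENT.  Coefficient arrays `a : ℕ → ℕ → ℂ` (entries beyond `2l` zero), the RAISING OPERATOR on arrays
`(raiseArr l a)_{jk} = (2l−j) a_{j+1,k} + (2l−k) a_{j,k+1}` (the transpose of `E Φ_{l,k+1} = (2l−k)Φ_{l,k}`), homogeneous parts `hpart n`
(`j + k = n`; `raiseArr ∘ hpart (n+1) = hpart n ∘ raiseArr`), and the CERTIFICATE FUNCTIONALS `cert N a = Σ_{j ≤ N} a_{j,N−j}(−1)^j C(N,j)`.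
★ `primitive_cert_ne_zero`: a non-zero antisymmetric array supported in `[0,2l]²`, homogeneous of degree `N` and killed by `raiseArr` has
ODD `N < 2l` and `cert N a ≠ 0` — along the anti-diagonal its entries are `u_j = (−1)^j ρ_j u_0` with explicit POSITIVE ratios `ρ_j`
(`rho`, `rho_pos`), so `cert N a = u_0 · Σ_j ρ_j C(N,j)` is a positive multiple of `u_0 ≠ 0` (an even degree would force the middle entry,
zero by antisymmetry, to be non-zero).  ★★ `eq_zero_of_cert_iterate_raiseArr`: an antisymmetric array supported in `[0,2l]²` all of whose
raised iterates have vanishing certificates in every odd degree `N < 2l` is ZERO (take a homogeneous part, follow its raising string to the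
last non-zero term — a primitive array — and read its certificate).  This is the highest-weight argument for `Λ²V_l` done on coordinates,
with no Lie-module infrastructure.

HONEST LABEL: finite-dimensional polynomial algebra about solid harmonics (W1's complex-coordinate currency `Zonal.CPoly = ℂ[W,V,Z]`,
`tripleC = −i·det(∇·,∇·,x)`, `lapC`, imported by name — nothing is re-declared); no statement about Navier–Stokes solutions is made or
proved in this file; `UnthreadedRigidity` ⟨27585⟩, W2 and NS regularity remain OPEN.  [folklore]
-/

-- the summit and its single sub-problem share the name (CONVENTIONS §1)
set_option linter.dupNamespace false

noncomputable section

open MvPolynomial Finsupp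

namespace Summit.NavierStokesRegularity.NavierStokesRegularity.Theorems.UnthreadedRigidity.VirialHorn.Coherent


/-! ## D. Coefficient arrays: raising, homogeneous parts, certificate functionals -/

section Arrays

open Finset

/-- the RAISING OPERATOR on coefficient arrays (transpose of `E Φ_{l,k+1} = (2l−k) Φ_{l,k}`):
`(E a)_{j,k} = (2l − j) a_{j+1,k} + (2l − k) a_{j,k+1}` (truncated subtraction: zero weights beyond `2l`). -/
def raiseArr (l : ℕ) (a : ℕ → ℕ → ℂ) : ℕ → ℕ → ℂ :=
  fun j k => ((2 * l - j : ℕ) : ℂ) * a (j + 1) k + ((2 * l - k : ℕ) : ℂ) * a j (k + 1)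

/-- the degree-`n` part of an array (`j + k = n`). -/
def hpart (n : ℕ) (a : ℕ → ℕ → ℂ) : ℕ → ℕ → ℂ := fun j k => if j + k = n then a j k else 0

/-- the CERTIFICATE FUNCTIONAL of degree `N`: `Λ_N(a) = Σ_{j ≤ N} a_{j,N−j} (−1)^j C(N,j)`. -/
def cert (N : ℕ) (a : ℕ → ℕ → ℂ) : ℂ := ∑ j ∈ range (N + 1), a j (N - j) * ((-1) ^ j * (N.choose j : ℂ))

variable {l : ℕ}

/-- raising the zero array. -/
theorem raiseArr_zero (l : ℕ) : raiseArr l 0 = 0 := by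
  funext j k; simp [raiseArr]

/-- iterated raising of the zero array. -/
theorem iterate_raiseArr_zero (l r : ℕ) : (raiseArr l)^[r] 0 = 0 := by
  induction r with
  | zero => rfl
  | succ r ih => rw [Function.iterate_succ_apply, raiseArr_zero, ih]

/-- raising preserves antisymmetry. -/
theorem raiseArr_antisymm {a : ℕ → ℕ → ℂ} (ha : ∀ j k, a k j = -a j k) (j k : ℕ) :
    raiseArr l a k j = -raiseArr l a j k := by
  simp only [raiseArr, ha (j + 1) k, ha j (k + 1)]
  ring

/-- iterated raising preserves antisymmetry. -/
theorem iterate_raiseArr_antisymm {a : ℕ → ℕ → ℂ} (ha : ∀ j k, a k j = -a j k) (r : ℕ) :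
    ∀ j k, (raiseArr l)^[r] a k j = -(raiseArr l)^[r] a j k := by
  induction r with
  | zero => exact ha
  | succ r ih => intro j k; rw [Function.iterate_succ_apply']; exact raiseArr_antisymm ih j k

/-- raising preserves the support square `[0, 2l]²`. -/
theorem raiseArr_supp {a : ℕ → ℕ → ℂ} (ha : ∀ j k, 2 * l < j ∨ 2 * l < k → a j k = 0) (j k : ℕ)
    (h : 2 * l < j ∨ 2 * l < k) : raiseArr l a j k = 0 := by
  simp only [raiseArr]
  rcases h with h | h
  · rw [ha j (k + 1) (Or.inl h), show 2 * l - j = 0 by omega]; simp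
  · rw [ha (j + 1) k (Or.inr h), show 2 * l - k = 0 by omega]; simp

/-- iterated raising preserves the support square. -/
theorem iterate_raiseArr_supp {a : ℕ → ℕ → ℂ} (ha : ∀ j k, 2 * l < j ∨ 2 * l < k → a j k = 0) (r : ℕ) :
    ∀ j k, 2 * l < j ∨ 2 * l < k → (raiseArr l)^[r] a j k = 0 := by
  induction r with
  | zero => exact ha
  | succ r ih => intro j k h; rw [Function.iterate_succ_apply']; exact raiseArr_supp ih j k h

/-- ★ raising lowers the degree by one: `E ∘ (degree n+1 part) = (degree n part) ∘ E`. -/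
theorem raiseArr_hpart_succ (n : ℕ) (a : ℕ → ℕ → ℂ) : raiseArr l (hpart (n + 1) a) = hpart n (raiseArr l a) := by
  funext j k
  simp only [raiseArr, hpart]
  by_cases h : j + k = n
  · rw [if_pos h, if_pos (by omega), if_pos (by omega)]
  · rw [if_neg h, if_neg (by omega), if_neg (by omega)]; simp

/-- iterated raising lowers the degree: `E^r ∘ (part n+r) = (part n) ∘ E^r`. -/
theorem iterate_raiseArr_hpart (n r : ℕ) (a : ℕ → ℕ → ℂ) :
    (raiseArr l)^[r] (hpart (n + r) a) = hpart n ((raiseArr l)^[r] a) := by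
  induction r generalizing a with
  | zero => rfl
  | succ r ih =>
    rw [Function.iterate_succ_apply, Function.iterate_succ_apply, show n + (r + 1) = (n + r) + 1 by ring,
      raiseArr_hpart_succ, ih]

/-- the full raising string of a homogeneous array ends in degree zero. -/
theorem iterate_raiseArr_hpart_self (n : ℕ) (a : ℕ → ℕ → ℂ) :
    (raiseArr l)^[n] (hpart n a) = hpart 0 ((raiseArr l)^[n] a) := by
  simpa using iterate_raiseArr_hpart (l := l) 0 n a

/-- the certificate functional of degree `N` only sees the degree-`N` part. -/
theorem cert_hpart (N : ℕ) (a : ℕ → ℕ → ℂ) : cert N (hpart N a) = cert N a := by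
  refine sum_congr rfl fun j hj => ?_
  rw [hpart, if_pos (by have := mem_range.mp hj; omega)]

/-- taking the degree-`n` part is idempotent. -/
theorem hpart_idem (n : ℕ) (a : ℕ → ℕ → ℂ) : hpart n (hpart n a) = hpart n a := by
  funext j k; by_cases h : j + k = n <;> simp [hpart, h]

/-- homogeneous parts of antisymmetric arrays are antisymmetric. -/
theorem hpart_antisymm {a : ℕ → ℕ → ℂ} (ha : ∀ j k, a k j = -a j k) (n j k : ℕ) : hpart n a k j = -hpart n a j k := by
  simp only [hpart, add_comm k j]
  split_ifs <;> simp [ha j k]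

/-- homogeneous parts stay in the support square. -/
theorem hpart_supp {a : ℕ → ℕ → ℂ} (ha : ∀ j k, 2 * l < j ∨ 2 * l < k → a j k = 0) (n j k : ℕ)
    (h : 2 * l < j ∨ 2 * l < k) : hpart n a j k = 0 := by
  simp [hpart, ha j k h]

/-- the degree-zero part of an antisymmetric array vanishes. -/
theorem hpart_zero_of_antisymm {a : ℕ → ℕ → ℂ} (ha : ∀ j k, a k j = -a j k) : hpart 0 a = 0 := by
  funext j k
  simp only [hpart, Pi.zero_apply]
  split_ifs with h
  · obtain ⟨rfl, rfl⟩ : j = 0 ∧ k = 0 := by omega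
    have := ha 0 0
    linear_combination this / 2
  · rfl

/-! ### primitive arrays -/

/-- the explicit ratio sequence of a primitive array of degree `N`: `ρ_0 = 1`, `ρ_{j+1} = ρ_j (2l+1+j−N)/(2l−j)`. -/
def rho (l N : ℕ) : ℕ → ℝ
  | 0 => 1
  | j + 1 => rho l N j * (((2 * l + 1 + j - N : ℕ) : ℝ) / ((2 * l - j : ℕ) : ℝ))

/-- the ratios `ρ_j` are positive for `N ≤ 2l`, `j ≤ 2l`. -/
theorem rho_pos {l N j : ℕ} (hN : N ≤ 2 * l) (hj : j ≤ 2 * l) : 0 < rho l N j := by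
  induction j with
  | zero => simp [rho]
  | succ j ih =>
    rw [rho]
    refine mul_pos (ih (by omega)) (div_pos ?_ ?_)
    · exact_mod_cast (show 0 < 2 * l + 1 + j - N by omega)
    · exact_mod_cast (show 0 < 2 * l - j by omega)

/-- ★ PRIMITIVE ARRAYS: a non-zero antisymmetric array supported in `[0,2l]²`, homogeneous of degree `N` and killed by the
raising operator has ODD degree `N < 2l` and a NON-ZERO certificate `Λ_N` (its entries alternate in sign along the
anti-diagonal, so `Λ_N` is a sum of positive multiples of one non-zero entry). -/
theorem primitive_cert_ne_zero {a : ℕ → ℕ → ℂ} {N : ℕ} (hanti : ∀ j k, a k j = -a j k)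
    (hsupp : ∀ j k, 2 * l < j ∨ 2 * l < k → a j k = 0) (hhom : hpart N a = a) (hE : raiseArr l a = 0)
    (hne : a ≠ 0) : N % 2 = 1 ∧ N < 2 * l ∧ cert N a ≠ 0 := by
  -- the anti-diagonal sequence `u_j = a_{j, N−j}` and its recursion
  set u : ℕ → ℂ := fun j => a j (N - j) with hu
  have hdeg : ∀ j k, a j k ≠ 0 → j + k = N := by
    intro j k h
    by_contra hjk
    apply h
    rw [← hhom, hpart, if_neg hjk]
  have hrec : ∀ j, j < N → ((2 * l - j : ℕ) : ℂ) * u (j + 1) + ((2 * l + 1 + j - N : ℕ) : ℂ) * u j = 0 := by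
    intro j hj
    have h := congrFun (congrFun hE j) (N - 1 - j)
    simp only [raiseArr, Pi.zero_apply] at h
    rw [hu]
    simp only
    rw [show N - (j + 1) = N - 1 - j by omega, show N - j = N - 1 - j + 1 by omega, show 2 * l + 1 + j - N = 2 * l - (N - 1 - j) by omega]
    exact h
  -- the step lemma: `u_j = 0`, `j < 2l` ⇒ `u_{j+1} = 0`
  have hstep : ∀ j, j < 2 * l → u j = 0 → u (j + 1) = 0 := by
    intro j hj h0
    by_cases hjN : j < N
    · have h := hrec j hjN
      rw [h0, mul_zero, add_zero] at h
      have hc : ((2 * l - j : ℕ) : ℂ) ≠ 0 := by exact_mod_cast (show 2 * l - j ≠ 0 by omega)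
      exact (mul_eq_zero.mp h).resolve_left hc
    · rw [hu]
      simp only
      by_contra h
      have := hdeg _ _ h
      omega
  have hchain : u 0 = 0 → ∀ j, u j = 0 := by
    intro h0 j
    induction j with
    | zero => exact h0
    | succ j ih =>
      by_cases hj : j < 2 * l
      · exact hstep j hj ih
      · rw [hu]; exact hsupp _ _ (Or.inl (by omega))
  have hu0 : u 0 ≠ 0 := by
    intro h0
    apply hne
    funext j k
    by_cases hjk : j + k = N
    · have := hchain h0 j
      rw [hu] at this
      simp only at this
      rw [show k = N - j by omega]
      exact this
    · rw [← hhom, hpart, if_neg hjk]; rfl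
  -- the degree is at most `2l`
  have hN : N ≤ 2 * l := by
    by_contra hN
    exact hu0 (hsupp 0 (N - 0) (Or.inr (by omega)))
  -- closed form along the anti-diagonal: `u_j = (−1)^j ρ_j u_0`
  have hclosed : ∀ j, j ≤ N → u j = (-1) ^ j * (rho l N j : ℂ) * u 0 := by
    intro j
    induction j with
    | zero => intro _; simp [rho]
    | succ j ih =>
      intro hj
      have h := hrec j (by omega)
      have hc : ((2 * l - j : ℕ) : ℂ) ≠ 0 := by exact_mod_cast (show 2 * l - j ≠ 0 by omega)
      have hc' : ((2 * l - j : ℕ) : ℝ) ≠ 0 := by exact_mod_cast (show 2 * l - j ≠ 0 by omega)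
      rw [ih (by omega)] at h
      rw [rho]
      push_cast
      field_simp
      linear_combination h
  -- `N` is odd: the middle entry of the anti-diagonal vanishes by antisymmetry
  have hodd : N % 2 = 1 := by
    by_contra hev
    have hm : u (N / 2) = 0 := by
      rw [hu]; simp only
      rw [show N - N / 2 = N / 2 by omega]
      have := hanti (N / 2) (N / 2)
      linear_combination this / 2
    rw [hclosed (N / 2) (by omega)] at hm
    have hρ : (rho l N (N / 2) : ℂ) ≠ 0 := by exact_mod_cast (rho_pos hN (by omega)).ne'
    have : ((-1 : ℂ) ^ (N / 2)) ≠ 0 := pow_ne_zero _ (by norm_num)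
    exact hu0 ((mul_eq_zero.mp hm).resolve_left (mul_ne_zero this hρ))
  refine ⟨hodd, by omega, ?_⟩
  -- the certificate is `u_0 · Σ_j ρ_j C(N,j)`, a positive multiple of `u_0`
  have hcert : cert N a = u 0 * ((∑ j ∈ range (N + 1), rho l N j * (N.choose j : ℝ) : ℝ) : ℂ) := by
    rw [cert, Complex.ofReal_sum, Finset.mul_sum]
    refine sum_congr rfl fun j hj => ?_
    have hj' : j ≤ N := by have := mem_range.mp hj; omega
    rw [show a j (N - j) = u j from rfl, hclosed j hj']
    push_cast
    have : ((-1 : ℂ) ^ j) * (-1) ^ j = 1 := by rw [← pow_add, ← two_mul, pow_mul]; norm_num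
    linear_combination (rho l N j : ℂ) * u 0 * (N.choose j : ℂ) * this
  rw [hcert]
  refine mul_ne_zero hu0 ?_
  have hpos : 0 < ∑ j ∈ range (N + 1), rho l N j * (N.choose j : ℝ) := by
    refine sum_pos (fun j hj => mul_pos (rho_pos hN ?_) ?_) ⟨0, by simp⟩
    · have := mem_range.mp hj; omega
    · exact_mod_cast Nat.choose_pos (by have := mem_range.mp hj; omega)
  exact_mod_cast hpos.ne'

/-- ★★ THE ARRAY THEOREM: an antisymmetric array supported in `[0,2l]²` all of whose raised iterates have vanishing
certificates in every odd degree `N < 2l` is zero. -/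
theorem eq_zero_of_cert_iterate_raiseArr {a : ℕ → ℕ → ℂ} (hanti : ∀ j k, a k j = -a j k)
    (hsupp : ∀ j k, 2 * l < j ∨ 2 * l < k → a j k = 0)
    (hcert : ∀ r N, N % 2 = 1 → N < 2 * l → cert N ((raiseArr l)^[r] a) = 0) : a = 0 := by
  -- every homogeneous part vanishes
  suffices h : ∀ n, hpart n a = 0 by
    funext j k
    have := congrFun (congrFun (h (j + k)) j) k
    simpa [hpart] using this
  intro n
  by_contra hb
  set b := hpart n a with hb_def
  -- the raising string of `b` dies: `E^n b` is the degree-0 part of something antisymmetric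
  have hkill : ∃ r, (raiseArr l)^[r] b = 0 := by
    refine ⟨n, ?_⟩
    rw [hb_def, iterate_raiseArr_hpart_self]
    exact hpart_zero_of_antisymm (iterate_raiseArr_antisymm hanti n)
  classical
  let r₁ := Nat.find hkill
  have hr₁ : (raiseArr l)^[r₁] b = 0 := Nat.find_spec hkill
  have hr₁pos : 0 < r₁ := by
    rw [Nat.pos_iff_ne_zero]
    intro h0
    rw [h0] at hr₁
    exact hb hr₁
  obtain ⟨r, hr⟩ : ∃ r, r₁ = r + 1 := ⟨r₁ - 1, by omega⟩
  set c := (raiseArr l)^[r] b with hc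
  have hc_ne : c ≠ 0 := Nat.find_min hkill (show r < r₁ by omega)
  have hEc : raiseArr l c = 0 := by
    have : raiseArr l c = (raiseArr l)^[r + 1] b := by rw [Function.iterate_succ_apply', hc]
    rw [this, ← hr]; exact hr₁
  have hrn : r < n := by
    by_contra hrn
    apply hc_ne
    obtain ⟨d, hd⟩ : ∃ d, r = n + d := ⟨r - n, by omega⟩
    rw [hc, hd, add_comm, Function.iterate_add_apply, hb_def, iterate_raiseArr_hpart_self,
      hpart_zero_of_antisymm (iterate_raiseArr_antisymm hanti n), iterate_raiseArr_zero]
  obtain ⟨N, hN⟩ : ∃ N, n = N + r := ⟨n - r, by omega⟩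
  -- `c` is homogeneous of degree `N`, antisymmetric, supported, primitive, non-zero
  have hc_hom : hpart N c = c := by
    rw [hc, hb_def, hN, iterate_raiseArr_hpart, hpart_idem]
  have hc_anti : ∀ j k, c k j = -c j k := iterate_raiseArr_antisymm (hpart_antisymm hanti n) r
  have hc_supp : ∀ j k, 2 * l < j ∨ 2 * l < k → c j k = 0 := iterate_raiseArr_supp (hpart_supp hsupp n) r
  obtain ⟨hodd, hlt, hne⟩ := primitive_cert_ne_zero hc_anti hc_supp hc_hom hEc hc_ne
  apply hne
  rw [hc, hb_def, hN, iterate_raiseArr_hpart, cert_hpart]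
  exact hcert r N hodd hlt

end Arrays

end Summit.NavierStokesRegularity.NavierStokesRegularity.Theorems.UnthreadedRigidity.VirialHorn.Coherent

end
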